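import Literature.NumberTheory.EllipticCurves.PrimaryTorsionFrobeniusUnramifiedProofs
import Literature.NumberTheory.EllipticCurves.HasseWeilGoodReductionFrobeniusProofs
import Literature.NumberTheory.EllipticCurves.FrobeniusEndomorphism
import Literature.NumberTheory.EllipticCurves.HasseWeilAbelianLSeriesProofs
import Literature.NumberTheory.EllipticCurves.JetchevSkinnerWan2017.SigmaImprimitiveCharIdeal
import HarnessLib

/-!
# `E[p^∞]^{Γ_{K_w}} ↪ Ẽ_w(k_w)` at a place `w ∤ p` of good reduction: the `p`-primary torsion
# rational over the decomposition group divides `#Ẽ_w(k_w) = Nw − a_w + 1` — PROVED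

Topic `NumberTheory/EllipticCurves`; namespace `WeierstrassCurve` (as the sibling
`PrimaryTorsionFrobeniusUnramifiedProofs`). THEOREMS ONLY (no definition, no named fact, no
instance, no `sorry`; D-0026). Cell `bsd-stepL` (typer lane `defn-ty1`, g9), module L4b (good
reduction) of the discharge plan for the named LOCAL fact
`JetchevSkinnerWan2017.sigmaLocal_charIdeal_eulerFactor_mem_of_noTamagawaDefect`
(`HOME/defn-ty1/g9/NOTE-sigmaLocal-discharge-plan-defn-ty1-g9.md`): at a totally split place of
GOOD reduction the local term is `#H¹(K_w, E[p^∞]) = #E(K_w)[p^∞]`, and this file bounds the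
latter by the Euler factor: `#E[p^∞]^{Γ_{K_w}} ∣ #Ẽ_w(k_w) = Nw − a_w + 1 = P_w|_{u=1}`.

## The printed statement

[SilvermanAEC2009] Prop. VII.3.1(b) (p. 170; = VIII.1.4): for `m ≥ 1` prime to the residue
characteristic and `Ẽ` nonsingular, "the reduction map `E(K)[m] → Ẽ(k)` is injective";
[GreenbergLNM1716] §2 (p. 71, `v ∤ p` of good reduction: "`E(K_v)[p^∞] → Ẽ(k_v)` is injective"),
used in [Castella2018] Prop. 2.5 / Thm. 2.3 (2.7) through `#H¹(K_w, E[p^∞])`.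

## What is proved

For an elliptic curve `W` over a number field `K`, a prime `p`, a finite place `w ∤ p` of good
reduction, and `E[p^∞] = PrimaryTorsion (geomPoints W) p` with the action of `Γ_{K_w}` through the
decomposition map `BigGaloisRep.localMap K (Sum.inl w)` (restriction along the chosen embedding
`K̄ → K̄_w`):
* `exists_addMonoidHom_primaryTorsion_invariants_injective` — an injective homomorphism
  `E[p^∞]^{Γ_{K_w}} ↪ Ẽ_w(k_w)`: the tree's reduction map on `p`-primary torsion along the chosen
  embedding (`exists_reduceTorsionHom`: VII.2.1 + VII.3.1(b), injective and Frobenius-equivariant)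
  sends a `Γ_{K_w}`-invariant point to a point fixed by the `q_w`-Frobenius of `k̄_w`, i.e. to a
  `k_w`-rational point (`smul_eq_self_iff_mem_range_toGeomPoints`);
* `finite_primaryTorsion_invariants`, **`natCard_primaryTorsion_invariants_dvd`** —
  `E[p^∞]^{Γ_{K_w}}` is finite and `#E[p^∞]^{Γ_{K_w}} ∣ #Ẽ_w(k_w)`;
* `natCard_primaryTorsion_invariants_dvd_of_isEulerDataAt`,
  `exists_eulerFactor_zero_eq_natCard_mul` — in the currency of the Euler data
  (`JetchevSkinnerWan2017.IsEulerDataAt W κ w Nw (.good a) c`): `#E[p^∞]^{Γ_{K_w}} ∣ Nw − a + 1`, and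
  the totally split Euler factor `eulerFactor p ℤ_[p] Nw (.good a) 0 = Nw − a + 1 ∈ Λ`
  (`eulerFactor_zero`) is a multiple of `#E[p^∞]^{Γ_{K_w}}` in `Λ`.

HONEST FRAMING: nothing is proved here about `H¹(K_w, E[p^∞])` (module L4a: `#H¹ = #H⁰` at
`ℓ ≠ p`) nor about places of bad reduction; the named fact is NOT discharged by this file.

References: [SilvermanAEC2009] Prop. VII.3.1(b), VII.2.1, V.§1 (proof of Thm. V.1.1: `E(k) = E(k̄)^{φ}`),
C.§16 (`a_v = q_v + 1 − #Ẽ_v(k_v)`); [GreenbergLNM1716] §2; [Castella2018] Prop. 2.5. Tree: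
`HasseWeilGoodReductionFrobeniusProofs` (`exists_reduceTorsionHom`,
`exists_isArithFrobAt_localAbsIntegers`), `FrobeniusEndomorphism` (`smul_eq_self_iff_mem_range_toGeomPoints`,
`finite_point`), `FrobeniusTateModule` (`exists_frobenius_absoluteGaloisGroup`),
`PrimaryTorsionFrobeniusUnramifiedProofs` (`resGalOfEmb_absClosureEmbedding`),
`HasseWeilAbelianLSeriesProofs` (`natCard_residueField_adicCompletionIntegers_eq_absNorm`),
`SigmaEulerFactors` (`eulerFactor_zero`).
-/

noncomputable section

open scoped Classical
open Field NumberField IsDedekindDomain IsDedekindDomain.HeightOneSpectrum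
open Literature.NumberTheory.EllipticCurves Literature.NumberTheory.EllipticCurves.BigGaloisRep
  Literature.NumberTheory.EllipticCurves.IwasawaCharacter Literature.NumberTheory.GaloisRepresentations

universe u

namespace WeierstrassCurve

section Reduction

variable {K : Type u} [Field K] [NumberField K] (W : WeierstrassCurve K) [W.IsElliptic]
  (p : ℕ) [Fact p.Prime] {w : HeightOneSpectrum (𝓞 K)}

/-- **`E[p^∞]^{Γ_{K_w}} ↪ Ẽ_w(k_w)` at a good place `w ∤ p`.** For an elliptic curve `W/K`, a prime
`p` and a finite place `w ∤ p` of good reduction there is an injective homomorphism from the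
`Γ_{K_w}`-invariants of `E[p^∞]` (action through `localMap K (Sum.inl w)`) to the `k_w`-points of
the reduction `Ẽ_w`: reduce along the chosen embedding `K̄ → K̄_w` (the tree's
`exists_reduceTorsionHom`, injective by VII.3.1(b)); an invariant point is fixed by a local
Frobenius, so its reduction is fixed by the `q_w`-Frobenius, hence `k_w`-rational
(`smul_eq_self_iff_mem_range_toGeomPoints`).
[cite: SilvermanAEC2009, Prop. VII.3.1(b) with Prop. VII.2.1 and V.§1 (proof of Thm. V.1.1)]
[cite: GreenbergLNM1716, §2 (p. 71, the reduction map on E(K_v)[p^∞] at v ∤ p of good reduction)] -/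
theorem exists_addMonoidHom_primaryTorsion_invariants_injective
    (hw : ((p : ℕ) : 𝓞 K) ∉ w.asIdeal) (hgood : W.HasGoodReductionAt w) :
    ∃ g : ((W.primaryTorsionGaloisRep p).restrict (localMap K (Sum.inl w))).toRepresentation.invariants →+
        (W.reductionAt w).toAffine.Point, Function.Injective g := by
  obtain ⟨𝔐, h𝔐⟩ := w.localPrimesAbove_nonempty
  obtain ⟨σL, hσL⟩ := w.exists_isArithFrobAt_localAbsIntegers h𝔐
  haveI : Finite (IsLocalRing.ResidueField (w.adicCompletionIntegers K)) :=
    finite_residueField_adicCompletionIntegers K w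
  obtain ⟨φ, hφ⟩ :=
    exists_frobenius_absoluteGaloisGroup (IsLocalRing.ResidueField (w.adicCompletionIntegers K))
  obtain ⟨f, hf, hfσ⟩ :=
    exists_reduceTorsionHom hw hgood h𝔐 (absClosureEmbedding K (w.adicCompletion K)) hσL hφ
  set ρw := (W.primaryTorsionGaloisRep p).restrict (localMap K (Sum.inl w)) with hρw
  -- an invariant point is fixed by the local Frobenius `σL`, so its reduction is fixed by `φ`
  have hfix : ∀ P : ρw.toRepresentation.invariants,
      φ • f (P : PrimaryTorsion (geomPoints W) p) = f (P : PrimaryTorsion (geomPoints W) p) := by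
    intro P
    have h1 : ρw σL (P : PrimaryTorsion (geomPoints W) p) = P :=
      (ρw.toRepresentation.mem_invariants (P : PrimaryTorsion (geomPoints W) p)).1 P.2 σL
    have h2 : resGalOfEmb (absClosureEmbedding K (w.adicCompletion K)) σL •
        (P : PrimaryTorsion (geomPoints W) p) = P := by
      rw [resGalOfEmb_absClosureEmbedding]
      exact h1
    have h3 := hfσ (P : PrimaryTorsion (geomPoints W) p)
    rw [← h3]
    congr 1
  -- hence it is `k_w`-rational
  have hmem : ∀ P : ρw.toRepresentation.invariants,
      f (P : PrimaryTorsion (geomPoints W) p) ∈ (toGeomPoints (W.reductionAt w)).range := fun P ↦ by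
    obtain ⟨Q, hQ⟩ := (smul_eq_self_iff_mem_range_toGeomPoints (W := W.reductionAt w) hφ _).1 (hfix P)
    exact ⟨Q, hQ⟩
  let f₀ : ρw.toRepresentation.invariants →+ geomPoints (W.reductionAt w) :=
    f.comp ρw.toRepresentation.invariants.subtype.toAddMonoidHom
  have hf₀ : ∀ P, f₀ P ∈ (toGeomPoints (W.reductionAt w)).range := fun P ↦ hmem P
  let e : (W.reductionAt w).toAffine.Point ≃+ (toGeomPoints (W.reductionAt w)).range :=
    AddMonoidHom.ofInjective (toGeomPoints_injective (W.reductionAt w))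
  refine ⟨e.symm.toAddMonoidHom.comp (f₀.codRestrict _ hf₀), ?_⟩
  intro P Q hPQ
  have h : f₀.codRestrict _ hf₀ P = f₀.codRestrict _ hf₀ Q := e.symm.injective hPQ
  have h' : f (P : PrimaryTorsion (geomPoints W) p) = f (Q : PrimaryTorsion (geomPoints W) p) :=
    congrArg Subtype.val h
  exact Subtype.ext (hf h')

/-- **`E[p^∞]^{Γ_{K_w}}` is finite** at a good place `w ∤ p` (it embeds in the finite group
`Ẽ_w(k_w)`). [cite: SilvermanAEC2009, Prop. VII.3.1(b)] -/
theorem finite_primaryTorsion_invariants (hw : ((p : ℕ) : 𝓞 K) ∉ w.asIdeal)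
    (hgood : W.HasGoodReductionAt w) :
    Finite ((W.primaryTorsionGaloisRep p).restrict (localMap K (Sum.inl w))).toRepresentation.invariants := by
  obtain ⟨g, hg⟩ := W.exists_addMonoidHom_primaryTorsion_invariants_injective p hw hgood
  haveI : Finite (IsLocalRing.ResidueField (w.adicCompletionIntegers K)) :=
    finite_residueField_adicCompletionIntegers K w
  haveI := finite_point (W.reductionAt w)
  exact Finite.of_injective g hg

/-- **`#E[p^∞]^{Γ_{K_w}} ∣ #Ẽ_w(k_w)`** at a good place `w ∤ p` (Lagrange, through the injective
reduction homomorphism). [cite: SilvermanAEC2009, Prop. VII.3.1(b)]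
[cite: GreenbergLNM1716, §2 (p. 71)] -/
theorem natCard_primaryTorsion_invariants_dvd (hw : ((p : ℕ) : 𝓞 K) ∉ w.asIdeal)
    (hgood : W.HasGoodReductionAt w) :
    Nat.card ((W.primaryTorsionGaloisRep p).restrict (localMap K (Sum.inl w))).toRepresentation.invariants ∣
      Nat.card (W.reductionAt w).toAffine.Point := by
  obtain ⟨g, hg⟩ := W.exists_addMonoidHom_primaryTorsion_invariants_injective p hw hgood
  exact AddSubgroup.card_dvd_of_injective g hg

omit [W.IsElliptic] in
/-- `#Ẽ_w(k_w) = N(w) − a_w + 1` (`a_w = q_w + 1 − #Ẽ_w(k_w)`, `q_w = #k_w = N(w)`).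
[cite: SilvermanAEC2009, C.§16 (a_v = q_v + 1 − #Ẽ_v(k_v))] -/
theorem natCard_point_reductionAt_eq (w : HeightOneSpectrum (𝓞 K)) :
    (Nat.card (W.reductionAt w).toAffine.Point : ℤ) =
      (Ideal.absNorm w.asIdeal : ℤ) - W.frobeniusTraceAt w + 1 := by
  rw [frobeniusTraceAt_def, natCard_residueField_adicCompletionIntegers_eq_absNorm]
  ring

end Reduction

/-! ## In the currency of the Euler data -/

section EulerData

variable {K : Type} [Field K] [NumberField K] (W : WeierstrassCurve K) [W.IsElliptic]
  (p : ℕ) [Fact p.Prime] (κ : ZpExtension K p) {w : HeightOneSpectrum (𝓞 K)}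

/-- **`#E[p^∞]^{Γ_{K_w}} ∣ Nw − a + 1`** for a place `w ∤ p` with Euler datum `(Nw, good a, c)`
(`JetchevSkinnerWan2017.IsEulerDataAt`: `Nw = N(w)`, `W` has good reduction at `w`, `a = a_w`).
[cite: SilvermanAEC2009, Prop. VII.3.1(b) and C.§16] [cite: Castella2018, Prop. 2.5 (the local terms at w ∤ p)] -/
theorem natCard_primaryTorsion_invariants_dvd_of_isEulerDataAt (hw : ((p : ℕ) : 𝓞 K) ∉ w.asIdeal)
    {Nw : ℕ} {a : ℤ} {c : ℤ_[p]} (hdata : JetchevSkinnerWan2017.IsEulerDataAt W κ w Nw (.good a) c) :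
    ((Nat.card ((W.primaryTorsionGaloisRep p).restrict
        (localMap K (Sum.inl w))).toRepresentation.invariants : ℕ) : ℤ) ∣ (Nw : ℤ) - a + 1 := by
  obtain ⟨hNw, -, hgood, ha⟩ := hdata
  rw [hNw, ha, ← W.natCard_point_reductionAt_eq w, Int.natCast_dvd_natCast]
  exact W.natCard_primaryTorsion_invariants_dvd p hw hgood

/-- **The totally split good Euler factor is a multiple of `#E[p^∞]^{Γ_{K_w}}` in `Λ`:** for a place
`w ∤ p` with Euler datum `(Nw, good a, c)`, `eulerFactor p ℤ_[p] Nw (.good a) 0 = (Nw − a + 1 : Λ)`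
(`eulerFactor_zero`) equals `#E[p^∞]^{Γ_{K_w}} · r` for some `r ∈ Λ = ℤ_p⟦T⟧` — the shape in which
the membership `#H¹(K_w, E[p^∞]) ∈ Ch_Λ` (module L3) upgrades to `P_w ∈ Ch_Λ` once
`#H¹(K_w, E[p^∞]) = #E(K_w)[p^∞]` (module L4a).
[cite: Castella2018, Thm. 2.3 (2.7) and Prop. 2.5] [cite: JetchevSkinnerWan2017, §5.1 (Remark on inert places)] -/
theorem exists_eulerFactor_zero_eq_natCard_mul (hw : ((p : ℕ) : 𝓞 K) ∉ w.asIdeal)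
    {Nw : ℕ} {a : ℤ} {c : ℤ_[p]} (hdata : JetchevSkinnerWan2017.IsEulerDataAt W κ w Nw (.good a) c) :
    ∃ r : IwasawaAlgebra p, eulerFactor p ℤ_[p] Nw (.good a) 0 =
      ((Nat.card ((W.primaryTorsionGaloisRep p).restrict
        (localMap K (Sum.inl w))).toRepresentation.invariants : ℕ) : IwasawaAlgebra p) * r := by
  obtain ⟨m, hm⟩ := W.natCard_primaryTorsion_invariants_dvd_of_isEulerDataAt p κ hw hdata
  refine ⟨(m : IwasawaAlgebra p), ?_⟩
  rw [eulerFactor_zero]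
  change ((Nw : PowerSeries ℤ_[p]) - a + 1) = _
  have h : ((Nw : ℤ) - a + 1 : ℤ) = (Nat.card ((W.primaryTorsionGaloisRep p).restrict
      (localMap K (Sum.inl w))).toRepresentation.invariants : ℤ) * m := hm
  have h' := congrArg (fun z : ℤ ↦ (z : PowerSeries ℤ_[p])) h
  simp only [Int.cast_add, Int.cast_sub, Int.cast_mul, Int.cast_natCast, Int.cast_one] at h'
  exact h'

end EulerData

end WeierstrassCurve

end
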